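/-
Copyright (c) 2026 the pub-hodgecm-mathlib formalisation cell (harness21).  Prover seat hodgecm-mathlib-K2E1-p16 (g3), Track B «K2-LIT» ENGINE E1, h413 = `stmt-HodgeConjecture-24833`,
route `HCCMUnconditional`, R90-S8 «ContSpec-n½», hCONT ROAD C, deal S8-R182 (B) (C3) (S8 dealer R90-CS-plan (g3)): CHANGING THE TRUNCATION LEVEL PRESERVES `L²`-HOLOMORPHY —
`[Λ^{T′} Ẽ(z)] − [Λ^{T} Ẽ(z)]` is an `L²(X)`-valued holomorphic family wherever the layer-2 letters `hEd hE4 hEbd hEcinv` hold (in fact only `hE4 hEbd hEcinv` and CT-holomorphy are used).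
-/
import Summits.HodgeConjecture.HodgeConjecture.Theorems.K2E1ChiContinuedTruncationBoundedCMThree        -- ★ p863796 (this seat): `measurable_quotFun_truncation_continued_cm_three`, `isOpen_slitPlane`; brings ★ reduction theory (`exists_torusSiegelSet`, `exists_isCompact_cover_three`), ★ CM Iwasawa
import Summits.HodgeConjecture.HodgeConjecture.Theorems.K2E1ChiConstantTermHolomorphicCMThree            -- ★ hE3c (K2E1-p10): `differentiableOn_borelConstantTerm_family`, (E2-bd)_B `locally_bounded_borelConstantTerm_family`
import Summits.HodgeConjecture.HodgeConjecture.Theorems.K2E1ChiContinuedEisensteinMiddleResidueCMThree   -- ★ T-hr2-1 (this base, g2): `truncation_apply_of_isMax`; brings ★ `exists_forall_borelHeight_mul_le`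
import Literature.NumberTheory.Automorphic.UnitaryGroupTorusSiegelHeightWindow                            -- ★ `isCompact_torusSiegel_heightWindow`
import Literature.Analysis.Complex.SquareIntegrableHolomorphicFamily                                     -- ★ `Literature.Analysis.Complex.analyticOnNhd_of_locally_bounded`
import HarnessLib

/-!
# h413 ∕ R90-S8 hCONT ROAD C, (C3) — `K2E1TruncationLevelChangeHolomorphicCMThree`: THE LEVEL-CHANGE `Λ^{T′} Ẽ(z) − Λ^{T} Ẽ(z)` OF THE CONTINUED FAMILY OF `U(2,1)` IS AN
# `L²(X, μ)`-VALUED HOLOMORPHIC FAMILY, so an `L²`-holomorphic truncated family at ONE level `T₀ ≥ 1` gives one at EVERY level `T ≥ 1`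

Cell `pub/hodgecm-mathlib`, crux H413 = `stmt-HodgeConjecture-24833`; S8 dealer R90-CS-plan (g3), ruling S8-R182 (B) «hCONT ROAD C — SWITCH», deal (C3); head shape posted for
K2E1-p10 (g5)'s (C2) on the R90 bus 2026-09-05T00:54Z.  THEOREMS ONLY (no `def`, no `instance`, no notation, no named-fact hypothesis, no `sorry`; default heartbeats); lane
`--supports stmt-HodgeConjecture-24833 --as helper` (count-neutral).  Closes no socket.

THE MATHEMATICS ([MoeglinWaldspurger1995, I.2.2, I.2.13, IV.2]; [Arthur1980TraceFormulaII, §1 Lemma 1.1 ∕ 1.4]; [BernsteinLapid2019, §4]; [Rogawski1990, §2.2]).  Above the floor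
(`1 ≤ T ≤ T′`), at the `z`-independent maximiser `γ₀` of `γ ↦ H(γy)` (★ `exists_forall_borelHeight_mul_le`), Arthur's truncations of a left-`G(F)`-invariant `u` on `U(J₃)(𝔸_F)` read
`Λ^{T} u(y) = u(y) − 𝟙[T < H(γ₀y)]·u_B(γ₀y)` (★ `truncation_apply_of_isMax`), hence the LEVEL CHANGE is the BAND FUNCTION
  `Λ^{T′} u(y) − Λ^{T} u(y) = 𝟙[T < H(γ₀y) ≤ T′] · u_B(γ₀y)`  (§1).
For the continued family `u = Ẽ(z) = Ec z`: (i) `z ↦` band is HOLOMORPHIC pointwise in `y` as soon as `z ↦ (Ec z)_B(g)` is (★ hE3c, from `hEd hE4 hEbd`); (ii) the band is BOUNDED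
LOCALLY UNIFORMLY in `z` WITHOUT any cusp-decay letter: `u_B` is left-`B(F)`-invariant (★ `borelConstantTerm_rational_borel_mul_of_rational_invariant`) and the `B(F)`-REPRESENTATIVES OF
THE HEIGHT WINDOW `{T ≤ H ≤ T′}` LIE IN ONE COMPACT `C` (§2: Tate's cover `β g = ω·s·k_B·k` ★ `exists_isCompact_cover_three` over the torus Siegel set ★ `exists_torusSiegelSet`,
`H(β g) = H(s)` ★, so `s` lies in the compact height window ★ `isCompact_torusSiegel_heightWindow`), on which the joint local bound (E2-bd)_B of `(z, g) ↦ (Ec z)_B(g)` (★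
`locally_bounded_borelConstantTerm_family`, from `hEbd`) applies; (iii) slices are Borel on `X` (★ p863796).  ★ `Literature.Analysis.Complex.analyticOnNhd_of_locally_bounded` then makes
`Band z := [Λ^{T′}(Ec z) − Λ^{T}(Ec z)] ∈ L²(X, μ)` an `L²`-VALUED HOLOMORPHIC family (§4), and `Fam_{T′} := Fam_T ± Band` transports `L²`-holomorphy between ANY two levels `T, T′ ≥ 1` (§4).
* §1 (generic `(F, E, c)`, `N = 3`) **`truncation_sub_truncation_apply_of_isMax`** (the band formula); **`differentiableOn_truncation_sub_truncation_of_letters_three`** (pointwise holomorphy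
  from `hEcinv` + CT-holomorphy `hE3c`, read on the quotient).
* §2 (generic, `[E:F] = 2`, `c² = 1 ≠ c`, Iwasawa) **`exists_isCompact_borel_representatives_heightWindow_three`** — `∃ C` compact, `∀ g, H₀ ≤ H(g) ≤ R → ∃ β ∈ B(F), β g ∈ C` (`0 < H₀`).
* §3 (generic) **`exists_nhds_forall_norm_truncation_sub_truncation_le_of_letters_three`** — the band is bounded on `G(𝔸)` locally uniformly in `z ∈ D` (`D` open), of the letters
  `hEcinv` and (E2-bd)_B `hBbd` on `D`.
* §4 (the CM pair `L ∕ L⁺`, `N = 3`, ANY OPEN `D` — `U n ∖ P`, `Pᶜ`, or the slit plane ★ `isOpen_slitPlane`; letters `hDo hEd hE4 hEbd hEcinv` + frame `μ` finite, `ν` Haar, `h𝓕N`, `h𝓕c`)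
  **`exists_L2Family_truncation_sub_truncation_cm_three`** (`1 ≤ T ≤ T′`: `∃ Band, DifferentiableOn ℂ Band D ∧ ∀ z ∈ D, ⇑(Band z) =ᵐ[μ] quotFun (Λ^{T′}(Ec z)) − quotFun (Λ^{T}(Ec z))`)
  and THE HEAD **`exists_L2Family_truncation_levelChange_cm_three`** (`1 ≤ T`, `1 ≤ T′`, either order: an `L²`-holomorphic family a.e.-representing `Λ^{T}(Ec ·)` on `D` yields one
  for `Λ^{T′}(Ec ·)`) — the (C2) step «per-ball `T₀(n)` → fixed `T`» BY NAME.  `hEd` enters only through ★ hE3c.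
HONEST LABEL: HC_CM is proved only modulo the 7 printed citations (2 remaining named inputs: hLiu418 = `stmt-HodgeConjecture-24832`, h413 = `stmt-HodgeConjecture-24833`) until rung 0
closes; this file asserts no named fact and closes no socket; its CM heads are CONDITIONAL exactly on the layer-2 letters `hEd hE4 hEbd hEcinv`; count-neutral.

## References
* [MoeglinWaldspurger1995] C. Mœglin, J.-L. Waldspurger, *Spectral Decomposition and Eisenstein Series* (1995), I.2.2, I.2.13, IV.2.
* [Arthur1980TraceFormulaII] J. Arthur, *A trace formula for reductive groups II*, Compositio Math. 40 (1980), §1 (Lemmas 1.1, 1.4), §4.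
* [BernsteinLapid2019] J. Bernstein, E. Lapid, *On the meromorphic continuation of Eisenstein series*, J. Amer. Math. Soc. 37 (2024), §4 (p. 10).
* [Rogawski1990] J. D. Rogawski, *Automorphic Representations of Unitary Groups in Three Variables* (1990), §2.2 (p. 13).
* [Borel1963] A. Borel, *Some finiteness properties of adele groups over number fields*, Publ. Math. IHÉS 16 (1963), §5.
-/

set_option autoImplicit false
-- the mandated namespace repeats the single-problem summit's segment (`HodgeConjecture.HodgeConjecture`)
set_option linter.dupNamespace false

noncomputable section

open MeasureTheory Measure NumberField IsDedekindDomain Set Filter Topology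
open scoped ENNReal NNReal Pointwise
open Literature.NumberTheory.Automorphic Literature.NumberTheory.Automorphic.UnitaryGroup AdelicGroupData
open Summit.HodgeConjecture.HodgeConjecture.Cruxes.H413.K2E1BLHeightCosetsU3 (exists_forall_borelHeight_mul_le)
open Summit.HodgeConjecture.HodgeConjecture.Cruxes.H413.K2E1ChiContinuedEisensteinMiddleResidueCMThree (truncation_apply_of_isMax)
open Summit.HodgeConjecture.HodgeConjecture.Cruxes.H413.K2E1ChiConstantTermHolomorphicCMThree (differentiableOn_borelConstantTerm_family locally_bounded_borelConstantTerm_family)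
open Summit.HodgeConjecture.HodgeConjecture.Cruxes.H413.K2E1ChiContinuedTruncationBoundedCMThree

namespace Summit.HodgeConjecture.HodgeConjecture.Cruxes.H413.K2E1TruncationLevelChangeHolomorphicCMThree

variable {F E : Type} [Field F] [NumberField F] [Field E] [NumberField E] [Algebra F E] {c : E ≃ₐ[F] E}

/-! ## §2 (stated first: no measure needed) `B(F)`-representatives of a height window lie in ONE compact -/

section Window

/-- **THE `B(F)`-REPRESENTATIVES OF A HEIGHT WINDOW LIE IN ONE COMPACT** (`U(J₃)`, `[E:F] = 2`, `c² = 1 ≠ c`, Iwasawa `hIw`; `0 < H₀`, any `R`): there is a compact `C ⊆ G(𝔸_F)` such that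
every `g` with `H₀ ≤ H(g) ≤ R` has a translate `β g ∈ C` by some RATIONAL BOREL `β ∈ B(F)`.  Tate's cover (★ `exists_isCompact_cover_three` over the torus Siegel set `S_T` of ★
`exists_torusSiegelSet`): `β g = ω·s·k_B·k`, `ω ∈ Ω ⊆ N(𝔸)` compact, `s ∈ S_T`, `k_B, k` over `K_max`; heights `H(β g) = H(g)` ★, `H(ω x) = H(x)` ★, `H(x k) = H(x)` ★ give `H(s) = H(g) ∈
[H₀, R]`, so `s` lies in the compact height window ★ `isCompact_torusSiegel_heightWindow`; `C := Ω · Window · K · K` with `K = val⁻¹ K_max` compact ★.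
[cite: Rogawski1990, §2.2 (p. 13)] [cite: Borel1963, §5] [cite: MoeglinWaldspurger1995, I.2.2] -/
theorem exists_isCompact_borel_representatives_heightWindow_three (h2 : Module.finrank F E = 2) (hc : c * c = 1) (hc1 : c ≠ 1)
    (hIw : ∀ g : (quasiSplit F E c 3).Adelic, ∃ b ∈ borelAdelic F E c 3, ∃ k : (quasiSplit F E c 3).Adelic,
      adelicVal F E c 3 ((StdForm.antidiagonal 3).over E) k ∈ standardMaximalCompactGL 3 E ∧ g = b * k)
    {H₀ : ℝ≥0} (hH₀ : 0 < H₀) (R : ℝ≥0) :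
    ∃ C : Set (quasiSplit F E c 3).Adelic, IsCompact C ∧ ∀ g : (quasiSplit F E c 3).Adelic, H₀ ≤ borelHeight g → borelHeight g ≤ R →
      ∃ β : (quasiSplit F E c 3).arithmeticSubgroup, β ∈ arithmeticBorel F E c 3 ∧ (β : (quasiSplit F E c 3).Adelic) * g ∈ C := by
  classical
  obtain ⟨ST, W, hSc, hW, hSTt, hexp, hSTcov, -, -⟩ := exists_torusSiegelSet (F := F) (E := E) (c := c) h2 hc1
  obtain ⟨Ω, hΩc, hΩN, hcov⟩ := exists_isCompact_cover_three hc hIw hSTcov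
  have hWin := isCompact_torusSiegel_heightWindow hc hSc hW hexp hH₀ R
  set Kpre : Set (quasiSplit F E c 3).Adelic := (((standardMaximalCompactGL 3 E).comap (adelicVal F E c 3 ((StdForm.antidiagonal 3).over E)) :
    Subgroup (quasiSplit F E c 3).Adelic) : Set (quasiSplit F E c 3).Adelic) with hKpre
  have hKc : IsCompact Kpre := isCompact_comap_adelicVal_standardMaximalCompactGL
  have hι : Continuous fun t : torusInBorel F E c 3 => ((t : borelAdelic F E c 3) : (quasiSplit F E c 3).Adelic) :=
    continuous_subtype_val.comp continuous_subtype_val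
  refine ⟨(((↑) : borelAdelic F E c 3 → (quasiSplit F E c 3).Adelic) '' Ω) *
      ((fun t : torusInBorel F E c 3 => ((t : borelAdelic F E c 3) : (quasiSplit F E c 3).Adelic)) '' {t : torusInBorel F E c 3 |
        (t : borelAdelic F E c 3) ∈ ST ∧ H₀ ≤ borelHeight ((t : borelAdelic F E c 3) : (quasiSplit F E c 3).Adelic) ∧
          borelHeight ((t : borelAdelic F E c 3) : (quasiSplit F E c 3).Adelic) ≤ R}) * Kpre * Kpre,
    (((hΩc.image continuous_subtype_val).mul (hWin.image hι)).mul hKc).mul hKc, fun g hg₀ hgR => ?_⟩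
  obtain ⟨β, hβ, b, hb, k, hk, hβg⟩ := hcov g
  obtain ⟨x, hx, kB, hkB, rfl⟩ := Set.mem_mul.1 hb
  obtain ⟨ω, hω, s, hs, rfl⟩ := Set.mem_mul.1 hx
  refine ⟨β, hβ, ?_⟩
  -- heights: `H(g) = H(β g) = H(ω s k_B k) = H(s)`
  have hk' : k ∈ ((standardMaximalCompactGL 3 E).comap (adelicVal F E c 3 ((StdForm.antidiagonal 3).over E)) : Subgroup (quasiSplit F E c 3).Adelic) :=
    Subgroup.mem_comap.2 hk
  have hkB' : ((kB : borelAdelic F E c 3) : (quasiSplit F E c 3).Adelic) ∈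
      ((standardMaximalCompactGL 3 E).comap (adelicVal F E c 3 ((StdForm.antidiagonal 3).over E)) : Subgroup (quasiSplit F E c 3).Adelic) :=
    Subgroup.mem_comap.2 hkB
  have hHs : borelHeight ((s : borelAdelic F E c 3) : (quasiSplit F E c 3).Adelic) = borelHeight g := by
    rw [← UnitaryGroup.borelHeight_arithmeticBorel_mul hβ g, hβg, borelHeight_mul_of_mem_comap_standardMaximalCompactGL hk', Subgroup.coe_mul, Subgroup.coe_mul, mul_assoc,
      borelHeight_unipotent_mul ((mem_unipotentInBorel_iff ω).1 (hΩN hω)), borelHeight_mul_of_mem_comap_standardMaximalCompactGL hkB']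
  -- `s` as a torus element in the window
  have hsT : (s : borelAdelic F E c 3) ∈ torusInBorel F E c 3 := (mem_torusInBorel_iff_torusPart_eq s).2 (hSTt s hs)
  have hwin : (⟨s, hsT⟩ : torusInBorel F E c 3) ∈ {t : torusInBorel F E c 3 | (t : borelAdelic F E c 3) ∈ ST ∧
      H₀ ≤ borelHeight ((t : borelAdelic F E c 3) : (quasiSplit F E c 3).Adelic) ∧ borelHeight ((t : borelAdelic F E c 3) : (quasiSplit F E c 3).Adelic) ≤ R} :=
    ⟨hs, by rw [Subgroup.coe_mk, hHs]; exact hg₀, by rw [Subgroup.coe_mk, hHs]; exact hgR⟩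
  rw [hβg, Subgroup.coe_mul, Subgroup.coe_mul]
  exact Set.mul_mem_mul (Set.mul_mem_mul (Set.mul_mem_mul ⟨ω, hω, rfl⟩ ⟨⟨s, hsT⟩, hwin, rfl⟩) hkB') hk'

end Window

/-! ## §1 Generic quadratic `(F, E, c)`, `N = 3`: the band formula and its pointwise holomorphy -/

section Band

variable [MeasurableSpace (quasiSplit F E c 3).Adelic] [BorelSpace (quasiSplit F E c 3).Adelic]

/-- **THE BAND FORMULA**: for `1 ≤ T ≤ T′`, a left-`G(F)`-invariant `u`, a point `y` and a maximiser `γ₀` of `γ ↦ H(γy)`: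
`Λ^{T′} u(y) − Λ^{T} u(y) = 𝟙[T < H(γ₀y) ≤ T′] · u_B(γ₀y)` (★ `truncation_apply_of_isMax` at both levels). [cite: Arthur1980TraceFormulaII, §1 (Lemma 1.1)] [cite: MoeglinWaldspurger1995, I.2.13] -/
theorem truncation_sub_truncation_apply_of_isMax (ν : Measure ↥(adelicUnipotent F E c 3)) [ν.IsHaarMeasure] {𝓕 : Set ↥(adelicUnipotent F E c 3)}
    (h𝓕 : IsFundamentalDomain ↥(rationalUnipotent F E c 3) 𝓕 ν) {T T' : ℝ≥0} (hT : 1 ≤ T) (hTT' : T ≤ T') {u : (quasiSplit F E c 3).Adelic → ℂ}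
    (hu : ∀ (γ : (quasiSplit F E c 3).arithmeticSubgroup) (x : (quasiSplit F E c 3).Adelic), u ((γ : (quasiSplit F E c 3).Adelic) * x) = u x)
    (y : (quasiSplit F E c 3).Adelic) (γ₀ : (quasiSplit F E c 3).arithmeticSubgroup)
    (hγ₀ : ∀ δ : (quasiSplit F E c 3).arithmeticSubgroup, borelHeight ((δ : (quasiSplit F E c 3).Adelic) * y) ≤ borelHeight ((γ₀ : (quasiSplit F E c 3).Adelic) * y)) :
    truncation ν 𝓕 T' u y - truncation ν 𝓕 T u y =
      if T < borelHeight ((γ₀ : (quasiSplit F E c 3).Adelic) * y) ∧ borelHeight ((γ₀ : (quasiSplit F E c 3).Adelic) * y) ≤ T' then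
        borelConstantTerm ν 𝓕 u ((γ₀ : (quasiSplit F E c 3).Adelic) * y) else 0 := by
  rw [truncation_apply_of_isMax ν h𝓕 (hT.trans hTT') hu y γ₀ hγ₀, truncation_apply_of_isMax ν h𝓕 hT hu y γ₀ hγ₀]
  by_cases h₁ : T < borelHeight ((γ₀ : (quasiSplit F E c 3).Adelic) * y)
  · by_cases h₂ : borelHeight ((γ₀ : (quasiSplit F E c 3).Adelic) * y) ≤ T'
    · rw [if_neg (not_lt.2 h₂), if_pos h₁, if_pos ⟨h₁, h₂⟩]; ring
    · rw [if_pos (not_le.1 h₂), if_pos h₁, if_neg (fun h => h₂ h.2)]; ring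
  · have h₂ : ¬ T' < borelHeight ((γ₀ : (quasiSplit F E c 3).Adelic) * y) := fun h => h₁ (lt_of_le_of_lt hTT' h)
    rw [if_neg h₂, if_neg h₁, if_neg (fun h => h₁ h.1), sub_self]

/-- **`z ↦ Λ^{T′}(Ec z)(y) − Λ^{T}(Ec z)(y)` IS HOLOMORPHIC ON `D` FOR EVERY `y`**, given left-`G(F)`-invariance `hEcinv` on `D` and the CT-holomorphy letter
`hE3c : ∀ g, DifferentiableOn ℂ (z ↦ (Ec z)_B(g)) D` (★ hE3c pays it from `hEd hE4 hEbd`): the band formula at the `z`-INDEPENDENT maximiser ★ `exists_forall_borelHeight_mul_le`; read on the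
quotient (`quotFun u x = u((out x)⁻¹)`), this is the `hdiff` input of ★ `analyticOnNhd_of_locally_bounded`. [cite: MoeglinWaldspurger1995, IV.2] [cite: BernsteinLapid2019, §4 (p. 10)] -/
theorem differentiableOn_truncation_sub_truncation_of_letters_three (ν : Measure ↥(adelicUnipotent F E c 3)) [ν.IsHaarMeasure] {𝓕 : Set ↥(adelicUnipotent F E c 3)}
    (h𝓕 : IsFundamentalDomain ↥(rationalUnipotent F E c 3) 𝓕 ν) {T T' : ℝ≥0} (hT : 1 ≤ T) (hTT' : T ≤ T')
    (Ec : ℂ → (quasiSplit F E c 3).Adelic → ℂ) {D : Set ℂ}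
    (hEcinv : ∀ z ∈ D, ∀ (γ : (quasiSplit F E c 3).arithmeticSubgroup) (x : (quasiSplit F E c 3).Adelic), Ec z ((γ : (quasiSplit F E c 3).Adelic) * x) = Ec z x)
    (hE3c : ∀ g, DifferentiableOn ℂ (fun z => borelConstantTerm ν 𝓕 (Ec z) g) D) :
    ∀ x : (quasiSplit F E c 3).automorphicQuotient, DifferentiableOn ℂ
      (fun z => (quasiSplit F E c 3).quotFun (truncation ν 𝓕 T' (Ec z)) x - (quasiSplit F E c 3).quotFun (truncation ν 𝓕 T (Ec z)) x) D := by
  intro x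
  set y : (quasiSplit F E c 3).Adelic := (Quotient.out (x : (quasiSplit F E c 3).Adelic ⧸ (quasiSplit F E c 3).quotientSubgroup))⁻¹ with hy
  obtain ⟨γ₀, hγ₀⟩ := exists_forall_borelHeight_mul_le y
  have heq : ∀ z ∈ D, (quasiSplit F E c 3).quotFun (truncation ν 𝓕 T' (Ec z)) x - (quasiSplit F E c 3).quotFun (truncation ν 𝓕 T (Ec z)) x =
      if T < borelHeight ((γ₀ : (quasiSplit F E c 3).Adelic) * y) ∧ borelHeight ((γ₀ : (quasiSplit F E c 3).Adelic) * y) ≤ T' then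
        borelConstantTerm ν 𝓕 (Ec z) ((γ₀ : (quasiSplit F E c 3).Adelic) * y) else 0 :=
    fun z hz => truncation_sub_truncation_apply_of_isMax ν h𝓕 hT hTT' (hEcinv z hz) y γ₀ hγ₀
  refine DifferentiableOn.congr ?_ heq
  by_cases h : T < borelHeight ((γ₀ : (quasiSplit F E c 3).Adelic) * y) ∧ borelHeight ((γ₀ : (quasiSplit F E c 3).Adelic) * y) ≤ T'
  · simp only [if_pos h]
    exact hE3c _
  · simp only [if_neg h]
    exact differentiableOn_const 0

/-! ## §3 Generic: the band is bounded locally uniformly in `z`, of the letters `hEcinv` and (E2-bd)_B -/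

/-- **THE BAND IS BOUNDED ON `G(𝔸)` LOCALLY UNIFORMLY IN `z ∈ D`, OF LETTERS** (`[E:F] = 2`, `c² = 1 ≠ c`, Iwasawa; `1 ≤ T ≤ T′`; `D` open): if on `D` the slices `Ec z` are left-`G(F)`-
invariant (`hEcinv`) and the CONSTANT TERMS are jointly locally bounded on compacts (`hBbd : ∀ z₁ ∈ D, ∀ K compact, ∃ V ∈ 𝓝 z₁, ∃ M, ∀ z ∈ V, ∀ g ∈ K, ‖(Ec z)_B g‖ ≤ M` — ★ (E2-bd)_B
from `hEbd`), then `∀ z₀ ∈ D, ∃ V ∈ 𝓝 z₀, V ⊆ D ∧ ∃ M, ∀ z ∈ V, ∀ y, ‖Λ^{T′}(Ec z)(y) − Λ^{T}(Ec z)(y)‖ ≤ M`: the band value is `u_B(γ₀y)` with `H(γ₀y) ∈ (T, T′]`, `u_B` is left-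
`B(F)`-invariant ★, and §2 moves `γ₀y` into ONE compact `C` by `B(F)` — where `hBbd z₀ C` bounds it. [cite: MoeglinWaldspurger1995, I.2.2, I.2.13] [cite: Arthur1980TraceFormulaII, §1 (Lemma 1.4)] -/
theorem exists_nhds_forall_norm_truncation_sub_truncation_le_of_letters_three (h2 : Module.finrank F E = 2) (hc : c * c = 1) (hc1 : c ≠ 1)
    (hIw : ∀ g : (quasiSplit F E c 3).Adelic, ∃ b ∈ borelAdelic F E c 3, ∃ k : (quasiSplit F E c 3).Adelic,
      adelicVal F E c 3 ((StdForm.antidiagonal 3).over E) k ∈ standardMaximalCompactGL 3 E ∧ g = b * k)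
    (ν : Measure ↥(adelicUnipotent F E c 3)) [ν.IsHaarMeasure] {𝓕 : Set ↥(adelicUnipotent F E c 3)}
    (h𝓕 : IsFundamentalDomain ↥(rationalUnipotent F E c 3) 𝓕 ν) {T T' : ℝ≥0} (hT : 1 ≤ T) (hTT' : T ≤ T')
    (Ec : ℂ → (quasiSplit F E c 3).Adelic → ℂ) {D : Set ℂ} (hDo : IsOpen D)
    (hEcinv : ∀ z ∈ D, ∀ (γ : (quasiSplit F E c 3).arithmeticSubgroup) (x : (quasiSplit F E c 3).Adelic), Ec z ((γ : (quasiSplit F E c 3).Adelic) * x) = Ec z x)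
    (hBbd : ∀ z₁ ∈ D, ∀ K : Set (quasiSplit F E c 3).Adelic, IsCompact K → ∃ V ∈ 𝓝 z₁, ∃ M : ℝ, ∀ z ∈ V, ∀ g ∈ K, ‖borelConstantTerm ν 𝓕 (Ec z) g‖ ≤ M)
    {z₀ : ℂ} (hz₀ : z₀ ∈ D) :
    ∃ V ∈ 𝓝 z₀, V ⊆ D ∧ ∃ M : ℝ, ∀ z ∈ V, ∀ y : (quasiSplit F E c 3).Adelic, ‖truncation ν 𝓕 T' (Ec z) y - truncation ν 𝓕 T (Ec z) y‖ ≤ M := by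
  obtain ⟨C, hC, hrep⟩ := exists_isCompact_borel_representatives_heightWindow_three h2 hc hc1 hIw (lt_of_lt_of_le one_pos hT) T'
  obtain ⟨V, hV, M, hM⟩ := hBbd z₀ hz₀ C hC
  refine ⟨V ∩ D, inter_mem hV (hDo.mem_nhds hz₀), inter_subset_right, max M 0, fun z hz y => ?_⟩
  obtain ⟨γ₀, hγ₀⟩ := exists_forall_borelHeight_mul_le y
  rw [truncation_sub_truncation_apply_of_isMax ν h𝓕 hT hTT' (hEcinv z hz.2) y γ₀ hγ₀]
  split_ifs with hband
  · obtain ⟨β, hβ, hβC⟩ := hrep _ hband.1.le hband.2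
    rw [← borelConstantTerm_rational_borel_mul_of_rational_invariant ν h𝓕 (hEcinv z hz.2) β hβ]
    exact (hM z hz.1 _ hβC).trans (le_max_left _ _)
  · rw [norm_zero]; exact le_max_right _ _

end Band

/-! ## §4 The CM pair `L ∕ L⁺`, `N = 3`, over any open `D`: the `L²(X, μ)`-valued band family and the level-change head -/

section CM

variable (L : Type) [Field L] [NumberField L] [IsCMField L]
variable [MeasurableSpace (quasiSplit (↥(maximalRealSubfield L)) L (IsCMField.complexConj L) 3).Adelic] [BorelSpace (quasiSplit (↥(maximalRealSubfield L)) L (IsCMField.complexConj L) 3).Adelic]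

/-- **(C3) THE `L²(X, μ)`-VALUED HOLOMORPHIC BAND FAMILY `z ↦ [Λ^{T′} Ẽ_χ(z) − Λ^{T} Ẽ_χ(z)]` ON AN OPEN `D`** (CM pair, `N = 3`; `μ` finite on `X`, `ν` Haar on `N(𝔸)`, `𝓕` a fundamental domain of `N(L⁺)`
of compact closure; the continued family `Ec` with the layer-2 letters `hEd hE4 hEbd hEcinv` on `D`; `1 ≤ T ≤ T′`): **`∃ Band : ℂ → L²(μ), DifferentiableOn ℂ Band D ∧ ∀ z ∈ D, ⇑(Band z) =ᵐ[μ]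
quotFun (Λ^{T′}(Ec z)) − quotFun (Λ^{T}(Ec z))`** — ★ `analyticOnNhd_of_locally_bounded` with `hdiff` = §1 (★ hE3c `differentiableOn_borelConstantTerm_family`), `hmeas` = ★ p863796
`measurable_quotFun_truncation_continued_cm_three` (twice), `hloc` = §3 (★ (E2-bd)_B `locally_bounded_borelConstantTerm_family`, `[L:L⁺] = 2`, `c² = 1 ≠ c`, Iwasawa ★), `Band z := (MemLp.of_bound …).toLp`.
[cite: MoeglinWaldspurger1995, I.2.13 and IV.2] [cite: BernsteinLapid2019, §4 (p. 10)] [cite: Arthur1980TraceFormulaII, §4] -/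
theorem exists_L2Family_truncation_sub_truncation_cm_three
    (μ : Measure (quasiSplit (↥(maximalRealSubfield L)) L (IsCMField.complexConj L) 3).automorphicQuotient) [IsFiniteMeasure μ]
    (ν : Measure ↥(adelicUnipotent (↥(maximalRealSubfield L)) L (IsCMField.complexConj L) 3)) [ν.IsHaarMeasure]
    {𝓕 : Set ↥(adelicUnipotent (↥(maximalRealSubfield L)) L (IsCMField.complexConj L) 3)}
    (h𝓕N : IsFundamentalDomain ↥(rationalUnipotent (↥(maximalRealSubfield L)) L (IsCMField.complexConj L) 3) 𝓕 ν) (h𝓕c : IsCompact (closure 𝓕))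
    (Ec : ℂ → (quasiSplit (↥(maximalRealSubfield L)) L (IsCMField.complexConj L) 3).Adelic → ℂ) {D : Set ℂ} (hDo : IsOpen D)
    (hEd : ∀ g, DifferentiableOn ℂ (fun z => Ec z g) D)
    (hE4 : ∀ z ∈ D, Continuous (Ec z))
    (hEbd : ∀ z₁ ∈ D, ∀ K : Set (quasiSplit (↥(maximalRealSubfield L)) L (IsCMField.complexConj L) 3).Adelic, IsCompact K → ∃ V ∈ 𝓝 z₁, ∃ M : ℝ, ∀ z ∈ V, ∀ g ∈ K, ‖Ec z g‖ ≤ M)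
    (hEcinv : ∀ z ∈ D, ∀ (γ : (quasiSplit (↥(maximalRealSubfield L)) L (IsCMField.complexConj L) 3).arithmeticSubgroup) (x : (quasiSplit (↥(maximalRealSubfield L)) L (IsCMField.complexConj L) 3).Adelic),
      Ec z ((γ : (quasiSplit (↥(maximalRealSubfield L)) L (IsCMField.complexConj L) 3).Adelic) * x) = Ec z x)
    {T T' : ℝ≥0} (hT : 1 ≤ T) (hTT' : T ≤ T') :
    ∃ Band : ℂ → (quasiSplit (↥(maximalRealSubfield L)) L (IsCMField.complexConj L) 3).L2 μ,
      DifferentiableOn ℂ Band D ∧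
      ∀ z ∈ D, ((Band z : (quasiSplit (↥(maximalRealSubfield L)) L (IsCMField.complexConj L) 3).L2 μ) : (quasiSplit (↥(maximalRealSubfield L)) L (IsCMField.complexConj L) 3).automorphicQuotient → ℂ) =ᵐ[μ]
        (quasiSplit (↥(maximalRealSubfield L)) L (IsCMField.complexConj L) 3).quotFun (truncation ν 𝓕 T' (Ec z)) -
          (quasiSplit (↥(maximalRealSubfield L)) L (IsCMField.complexConj L) 3).quotFun (truncation ν 𝓕 T (Ec z)) := by
  classical
  have h𝓕top : ν 𝓕 ≠ ∞ := ((measure_mono subset_closure).trans_lt h𝓕c.measure_lt_top).ne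
  -- the letters of §1 ∕ §3: CT-holomorphy ★ hE3c and (E2-bd)_B ★
  have hE3c : ∀ g, DifferentiableOn ℂ (fun z => borelConstantTerm ν 𝓕 (Ec z) g) D :=
    differentiableOn_borelConstantTerm_family ν h𝓕N.nullMeasurableSet h𝓕top h𝓕c Ec hDo hEd hE4 hEbd
  have hBbd := locally_bounded_borelConstantTerm_family ν h𝓕c Ec hEbd
  -- `hdiff`, `hmeas`, `hloc`
  have hdiff := differentiableOn_truncation_sub_truncation_of_letters_three ν h𝓕N hT hTT' Ec hEcinv hE3c
  have hmeas : ∀ s ∈ D, AEStronglyMeasurable (fun x => (quasiSplit (↥(maximalRealSubfield L)) L (IsCMField.complexConj L) 3).quotFun (truncation ν 𝓕 T' (Ec s)) x -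
      (quasiSplit (↥(maximalRealSubfield L)) L (IsCMField.complexConj L) 3).quotFun (truncation ν 𝓕 T (Ec s)) x) μ := fun s hs =>
    ((measurable_quotFun_truncation_continued_cm_three L ν h𝓕N Ec hE4 hEcinv (hT.trans hTT') hs).sub
      (measurable_quotFun_truncation_continued_cm_three L ν h𝓕N Ec hE4 hEcinv hT hs)).aestronglyMeasurable
  have hloc : ∀ s₀ ∈ D, ∃ V ∈ 𝓝 s₀, ∃ C : ℝ, ∀ s ∈ V, ∀ x : (quasiSplit (↥(maximalRealSubfield L)) L (IsCMField.complexConj L) 3).automorphicQuotient,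
      ‖(quasiSplit (↥(maximalRealSubfield L)) L (IsCMField.complexConj L) 3).quotFun (truncation ν 𝓕 T' (Ec s)) x -
        (quasiSplit (↥(maximalRealSubfield L)) L (IsCMField.complexConj L) 3).quotFun (truncation ν 𝓕 T (Ec s)) x‖ ≤ C := fun s₀ hs₀ => by
    obtain ⟨V, hV, -, M, hM⟩ := exists_nhds_forall_norm_truncation_sub_truncation_le_of_letters_three (Algebra.IsQuadraticExtension.finrank_eq_two (↥(maximalRealSubfield L)) L)
      (AlgEquiv.ext fun x => IsCMField.complexConj_apply_apply L x) (IsCMField.complexConj_ne_one L) (exists_mem_borelAdelic_mul_mem_standardMaximalCompactGL_cm_three L)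
      ν h𝓕N hT hTT' Ec hDo hEcinv hBbd hs₀
    exact ⟨V, hV, M, fun s hs x => hM s hs _⟩
  -- every slice on `D` is in `L²(μ)`
  have hmem : ∀ s ∈ D, MemLp (fun x => (quasiSplit (↥(maximalRealSubfield L)) L (IsCMField.complexConj L) 3).quotFun (truncation ν 𝓕 T' (Ec s)) x -
      (quasiSplit (↥(maximalRealSubfield L)) L (IsCMField.complexConj L) 3).quotFun (truncation ν 𝓕 T (Ec s)) x) 2 μ := fun s hs => by
    obtain ⟨V, hV, C, hC⟩ := hloc s hs
    exact MemLp.of_bound (hmeas s hs) C (ae_of_all _ fun x => hC s (mem_of_mem_nhds hV) x)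
  refine ⟨fun z => if hz : z ∈ D then (hmem z hz).toLp _ else 0, ?_, fun z hz => ?_⟩
  · have hF : ∀ s ∈ D, (((fun z => if hz : z ∈ D then (hmem z hz).toLp _ else (0 : (quasiSplit (↥(maximalRealSubfield L)) L (IsCMField.complexConj L) 3).L2 μ)) s :
          (quasiSplit (↥(maximalRealSubfield L)) L (IsCMField.complexConj L) 3).L2 μ) : (quasiSplit (↥(maximalRealSubfield L)) L (IsCMField.complexConj L) 3).automorphicQuotient → ℂ) =ᵐ[μ]
          fun x => (quasiSplit (↥(maximalRealSubfield L)) L (IsCMField.complexConj L) 3).quotFun (truncation ν 𝓕 T' (Ec s)) x -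
            (quasiSplit (↥(maximalRealSubfield L)) L (IsCMField.complexConj L) 3).quotFun (truncation ν 𝓕 T (Ec s)) x := fun s hs => by
      simp only [dif_pos hs]
      exact (hmem s hs).coeFn_toLp
    exact (Literature.Analysis.Complex.analyticOnNhd_of_locally_bounded (μ := μ) hDo hdiff hmeas hloc hF).differentiableOn
  · simp only [dif_pos hz]
    exact (hmem z hz).coeFn_toLp

/-- **(C3) HEAD — CHANGING THE TRUNCATION LEVEL PRESERVES `L²`-HOLOMORPHY** (CM pair, `N = 3`, open `D`, letters `hEd hE4 hEbd hEcinv`, frame `μ` finite, `ν` Haar, `h𝓕N`, `h𝓕c`): for ANY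
two levels `T, T′ ≥ 1` (either order), an `L²(μ)`-valued family holomorphic on `D` and a.e.-representing `Λ^{T}(Ec z)` yields one a.e.-representing `Λ^{T′}(Ec z)` — `Fam′ := Fam + Band`
(`T ≤ T′`) or `Fam − Band` (`T′ ≤ T`) with the band family above.  The (C2) step «per-ball level `T₀(n)` → one fixed `T`» by name.
[cite: MoeglinWaldspurger1995, IV.2] [cite: BernsteinLapid2019, §4 (p. 10)] [cite: Arthur1980TraceFormulaII, §1 (Lemma 1.1) and §4] -/
theorem exists_L2Family_truncation_levelChange_cm_three
    (μ : Measure (quasiSplit (↥(maximalRealSubfield L)) L (IsCMField.complexConj L) 3).automorphicQuotient) [IsFiniteMeasure μ]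
    (ν : Measure ↥(adelicUnipotent (↥(maximalRealSubfield L)) L (IsCMField.complexConj L) 3)) [ν.IsHaarMeasure]
    {𝓕 : Set ↥(adelicUnipotent (↥(maximalRealSubfield L)) L (IsCMField.complexConj L) 3)}
    (h𝓕N : IsFundamentalDomain ↥(rationalUnipotent (↥(maximalRealSubfield L)) L (IsCMField.complexConj L) 3) 𝓕 ν) (h𝓕c : IsCompact (closure 𝓕))
    (Ec : ℂ → (quasiSplit (↥(maximalRealSubfield L)) L (IsCMField.complexConj L) 3).Adelic → ℂ) {D : Set ℂ} (hDo : IsOpen D)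
    (hEd : ∀ g, DifferentiableOn ℂ (fun z => Ec z g) D)
    (hE4 : ∀ z ∈ D, Continuous (Ec z))
    (hEbd : ∀ z₁ ∈ D, ∀ K : Set (quasiSplit (↥(maximalRealSubfield L)) L (IsCMField.complexConj L) 3).Adelic, IsCompact K → ∃ V ∈ 𝓝 z₁, ∃ M : ℝ, ∀ z ∈ V, ∀ g ∈ K, ‖Ec z g‖ ≤ M)
    (hEcinv : ∀ z ∈ D, ∀ (γ : (quasiSplit (↥(maximalRealSubfield L)) L (IsCMField.complexConj L) 3).arithmeticSubgroup) (x : (quasiSplit (↥(maximalRealSubfield L)) L (IsCMField.complexConj L) 3).Adelic),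
      Ec z ((γ : (quasiSplit (↥(maximalRealSubfield L)) L (IsCMField.complexConj L) 3).Adelic) * x) = Ec z x)
    {T T' : ℝ≥0} (hT : 1 ≤ T) (hT' : 1 ≤ T')
    (hFam : ∃ Fam : ℂ → (quasiSplit (↥(maximalRealSubfield L)) L (IsCMField.complexConj L) 3).L2 μ,
      DifferentiableOn ℂ Fam D ∧
      ∀ z ∈ D, ((Fam z : (quasiSplit (↥(maximalRealSubfield L)) L (IsCMField.complexConj L) 3).L2 μ) : (quasiSplit (↥(maximalRealSubfield L)) L (IsCMField.complexConj L) 3).automorphicQuotient → ℂ) =ᵐ[μ]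
        (quasiSplit (↥(maximalRealSubfield L)) L (IsCMField.complexConj L) 3).quotFun (truncation ν 𝓕 T (Ec z))) :
    ∃ Fam' : ℂ → (quasiSplit (↥(maximalRealSubfield L)) L (IsCMField.complexConj L) 3).L2 μ,
      DifferentiableOn ℂ Fam' D ∧
      ∀ z ∈ D, ((Fam' z : (quasiSplit (↥(maximalRealSubfield L)) L (IsCMField.complexConj L) 3).L2 μ) : (quasiSplit (↥(maximalRealSubfield L)) L (IsCMField.complexConj L) 3).automorphicQuotient → ℂ) =ᵐ[μ]
        (quasiSplit (↥(maximalRealSubfield L)) L (IsCMField.complexConj L) 3).quotFun (truncation ν 𝓕 T' (Ec z)) := by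
  obtain ⟨Fam, hFd, hFam⟩ := hFam
  rcases le_total T T' with hle | hle
  · -- up: `Fam′ := Fam + Band_{T}^{T′}`
    obtain ⟨Band, hBd, hBand⟩ := exists_L2Family_truncation_sub_truncation_cm_three L μ ν h𝓕N h𝓕c Ec hDo hEd hE4 hEbd hEcinv hT hle
    refine ⟨fun z => Fam z + Band z, hFd.add hBd, fun z hz => ?_⟩
    filter_upwards [Lp.coeFn_add (Fam z) (Band z), hFam z hz, hBand z hz] with x hx h₁ h₂
    rw [hx, Pi.add_apply, h₁, h₂, Pi.sub_apply, add_sub_cancel]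
  · -- down: `Fam′ := Fam − Band_{T′}^{T}`
    obtain ⟨Band, hBd, hBand⟩ := exists_L2Family_truncation_sub_truncation_cm_three L μ ν h𝓕N h𝓕c Ec hDo hEd hE4 hEbd hEcinv hT' hle
    refine ⟨fun z => Fam z - Band z, hFd.sub hBd, fun z hz => ?_⟩
    filter_upwards [Lp.coeFn_sub (Fam z) (Band z), hFam z hz, hBand z hz] with x hx h₁ h₂
    rw [hx, Pi.sub_apply, h₁, h₂, Pi.sub_apply, sub_sub_cancel]

end CM

end Summit.HodgeConjecture.HodgeConjecture.Cruxes.H413.K2E1TruncationLevelChangeHolomorphicCMThree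

end
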